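import Summits.Ventures.HodgeRepro2.T5SU11KernelBracket
import Summits.Ventures.HodgeRepro2.T5SU11ResolventKernelComposition
import Summits.Ventures.HodgeRepro2.T5SU11RadialGreenPositivity

/-!
# The kernel resolvent identity: `∫_{(0,∞)} K_λ(t, r) K_{λ₂}(r, s) sinh 2r dr = (K_λ(t, s) − K_{λ₂}(t, s))/(μ − μ₂)`

For `λ, λ₂ > 1` and `t, s > 0` the product of the Green's kernels `K_λ(t, r) = −φ_λ(min(t,r)) χ_λ(max(t,r))` (row 461)
integrates in closed form: for `t ≤ s` the integral splits at `t` and `s` into the three Lagrange integrals of row 510,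

`(μ − μ₂) ∫_{(0,∞)} K_λ(t,r) K_{λ₂}(r,s) sinh 2r dr = χ_λ(t) χ_{λ₂}(s) W_{φφ}(t) + φ_λ(t) χ_{λ₂}(s) (W_{χφ}(s) − W_{χφ}(t))
  − φ_λ(t) φ_{λ₂}(s) W_{χχ}(s)`,

and the two Wronskians `sinh 2t (φ_λ χ_λ′ − φ_λ′ χ_λ)(t) = −1`, `sinh 2s (φ_{λ₂} χ_{λ₂}′ − φ_{λ₂}′ χ_{λ₂})(s) = −1` reduce
the right-hand side to `φ_{λ₂}(t) χ_{λ₂}(s) − φ_λ(t) χ_λ(s) = K_λ(t, s) − K_{λ₂}(t, s)`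
(`kernel_resolvent_identity_of_le`); the case `t > s` follows by the symmetry of the kernels
(`kernel_resolvent_identity`). Hence

* **`kernel_comp_eq`** — for `λ ≠ λ₂`, `∫_{(0,∞)} K_λ(t,r) K_{λ₂}(r,s) sinh 2r dr = (K_λ(t,s) − K_{λ₂}(t,s))/(μ − μ₂)`:
  the Fubini kernel of `G_λ G_{λ₂}` IS the difference quotient of row 509 — the resolvent identity at the level of
  kernels, proved without Fubini;
* **`sphGreen_comp_eq_integral_kernel_comp`** — `G^I_λ(G_{λ₂} f)(t) = ∫_a^b (∫_{(0,∞)} K_λ(t,r) K_{λ₂}(r,s) sinh 2r dr)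
  f(s) sinh 2s ds` for `f` supported in `[a, b]` (candidate (cxix) of the support record, closed);
* `kernel_comp_nonneg`, **`sphGreenKernel_mono`** — the composed kernel is nonnegative, hence the Green's kernel is
  monotone in the spectral parameter: `K_{λ₂}(t, s) ≤ K_λ(t, s) ≤ 0` for `1 < λ₂ ≤ λ`.

Nothing is claimed about (N).

Blind lane: Mathlib + the HodgeRepro2 prefix only; no sorry; axioms ⊆ {propext, Classical.choice,
Quot.sound}.
-/

namespace Summit.Ventures.HodgeRepro2.T5SU11KernelResolventIdentity

open Filter Topology MeasureTheory intervalIntegral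
open Set (Ioi Ioc Icc)
open T5SU11Cartan T5SU11SphericalFunction T5SU11SphericalContinuous T5SU11SphericalSolutionSpaceAll
  T5SU11SphericalDecay T5SU11RadialGreenKernel T5SU11SphericalGreen T5SU11RadialGreenImproper
  T5SU11ResolventCommute T5SU11KernelBracket T5SU11ResolventKernelComposition T5SU11RadialGreenPositivity

section measure

variable [MeasurableSpace Circle] [BorelSpace Circle]

variable {lam lam₂ : ℝ} (hlam : 1 < lam) (hlam₂ : 1 < lam₂)

include hlam hlam₂ in
/-- **The kernel resolvent identity for `t ≤ s`**:
`(μ − μ₂) ∫_{(0,∞)} K_λ(t,r) K_{λ₂}(r,s) sinh 2r dr = K_λ(t,s) − K_{λ₂}(t,s)`. -/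
theorem kernel_resolvent_identity_of_le {t s : ℝ} (ht : 0 < t) (hts : t ≤ s) :
    (lam * (lam - 2) - lam₂ * (lam₂ - 2))
        * ∫ r in Ioi 0, sphGreenKernel lam t r * sphGreenKernel lam₂ r s * Real.sinh (2 * r)
      = sphGreenKernel lam t s - sphGreenKernel lam₂ t s := by
  have hs : 0 < s := lt_of_lt_of_le ht hts
  set F : ℝ → ℝ := fun r => sphGreenKernel lam t r * sphGreenKernel lam₂ r s * Real.sinh (2 * r) with hF
  -- the integrand on the three pieces
  have e1 : Set.EqOn F (fun r => sphDecay lam t * sphDecay lam₂ s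
      * (sph lam (hyp r) * sph lam₂ (hyp r) * Real.sinh (2 * r))) (Ioc 0 t) := by
    intro r hr
    simp only [hF, sphGreenKernel]
    rw [greenKernel_of_le _ _ hr.2, greenKernel_of_ge _ _ (le_trans hr.2 hts)]
    ring
  have e2 : Set.EqOn F (fun r => sph lam (hyp t) * sphDecay lam₂ s
      * (sphDecay lam r * sph lam₂ (hyp r) * Real.sinh (2 * r))) (Ioc t s) := by
    intro r hr
    simp only [hF, sphGreenKernel]
    rw [greenKernel_of_ge _ _ hr.1.le, greenKernel_of_ge _ _ hr.2]
    ring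
  have e3 : Set.EqOn F (fun r => sph lam (hyp t) * sph lam₂ (hyp s)
      * (sphDecay lam r * sphDecay lam₂ r * Real.sinh (2 * r))) (Ioi s) := by
    intro r hr
    have hr' : s < r := hr
    simp only [hF, sphGreenKernel]
    rw [greenKernel_of_ge _ _ (le_trans hts hr'.le), greenKernel_of_le _ _ hr'.le]
    ring
  -- integrability on the three pieces
  have hχ : ContinuousOn (sphDecay lam) (Ioi 0) :=
    fun _ hr => (hasDerivAt_sphDecay hlam hr).continuousAt.continuousWithinAt
  have hI1 : IntegrableOn F (Ioc 0 t) := by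
    refine IntegrableOn.congr_fun ?_ e1.symm measurableSet_Ioc
    exact Continuous.integrableOn_Ioc (continuous_const.mul (((continuous_sph_hyp lam).mul
      (continuous_sph_hyp lam₂)).mul (Real.continuous_sinh.comp (continuous_const.mul continuous_id))))
  have hI2 : IntegrableOn F (Ioc t s) := by
    refine IntegrableOn.congr_fun ?_ e2.symm measurableSet_Ioc
    have hc : ContinuousOn (fun r => sph lam (hyp t) * sphDecay lam₂ s
        * (sphDecay lam r * sph lam₂ (hyp r) * Real.sinh (2 * r))) (Icc t s) :=
      (continuousOn_const.mul (((hχ.mono (fun r hr => lt_of_lt_of_le ht hr.1)).mul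
        (continuous_sph_hyp lam₂).continuousOn).mul
        (Real.continuous_sinh.comp (continuous_const.mul continuous_id)).continuousOn))
    exact hc.integrableOn_Icc.mono_set Set.Ioc_subset_Icc_self
  have hI3 : IntegrableOn F (Ioi s) := by
    refine IntegrableOn.congr_fun ?_ e3.symm measurableSet_Ioi
    exact (integrableOn_sphDecay_mul_sphDecay_mul_sinh hlam hlam₂ hs).const_mul _
  -- split the integral
  have hsplit1 : Ioc 0 s ∪ Ioi s = Ioi 0 := Set.Ioc_union_Ioi_eq_Ioi hs.le
  have hsplit2 : Ioc 0 t ∪ Ioc t s = Ioc 0 s := Set.Ioc_union_Ioc_eq_Ioc ht.le hts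
  have hd1 : Disjoint (Ioc 0 s) (Ioi s) := Set.Ioc_disjoint_Ioi le_rfl
  have hd2 : Disjoint (Ioc 0 t) (Ioc t s) := Set.Ioc_disjoint_Ioc_of_le le_rfl
  have hI12 : IntegrableOn F (Ioc 0 s) := by
    rw [← hsplit2]; exact hI1.union hI2
  have hint : ∫ r in Ioi 0, F r = (∫ r in Ioc 0 t, F r) + (∫ r in Ioc t s, F r) + ∫ r in Ioi s, F r := by
    rw [← hsplit1, setIntegral_union hd1 measurableSet_Ioi hI12 hI3, ← hsplit2,
      setIntegral_union hd2 measurableSet_Ioc hI1 hI2]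
  -- the three pieces in closed form (row 510)
  have h1 := integral_sph_mul_sph lam lam₂ ht.le
  have h2 := integral_sphDecay_mul_sph hlam lam₂ ht hts
  have h3 := integral_sphDecay_mul_sphDecay_Ioi hlam hlam₂ hs
  have p1 : ∫ r in Ioc 0 t, F r = sphDecay lam t * sphDecay lam₂ s
      * ∫ r in (0 : ℝ)..t, sph lam (hyp r) * sph lam₂ (hyp r) * Real.sinh (2 * r) := by
    rw [setIntegral_congr_fun measurableSet_Ioc e1, MeasureTheory.integral_const_mul, integral_of_le ht.le]
  have p2 : ∫ r in Ioc t s, F r = sph lam (hyp t) * sphDecay lam₂ s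
      * ∫ r in t..s, sphDecay lam r * sph lam₂ (hyp r) * Real.sinh (2 * r) := by
    rw [setIntegral_congr_fun measurableSet_Ioc e2, MeasureTheory.integral_const_mul, integral_of_le hts]
  have p3 : ∫ r in Ioi s, F r = sph lam (hyp t) * sph lam₂ (hyp s)
      * ∫ r in Ioi s, sphDecay lam r * sphDecay lam₂ r * Real.sinh (2 * r) := by
    rw [setIntegral_congr_fun measurableSet_Ioi e3, MeasureTheory.integral_const_mul]
  -- the Wronskians at `t` (parameter `λ`) and at `s` (parameter `λ₂`)
  have hwt := wronskian_sphDecay hlam ht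
  have hws := wronskian_sphDecay hlam₂ hs
  -- assemble
  show (lam * (lam - 2) - lam₂ * (lam₂ - 2)) * ∫ r in Ioi 0, F r = _
  rw [hint, p1, p2, p3, sphGreenKernel, sphGreenKernel, greenKernel_of_ge _ _ hts, greenKernel_of_ge _ _ hts]
  linear_combination (sphDecay lam t * sphDecay lam₂ s) * h1 + (sph lam (hyp t) * sphDecay lam₂ s) * h2
    + (sph lam (hyp t) * sph lam₂ (hyp s)) * h3 - (sphDecay lam₂ s * sph lam₂ (hyp t)) * hwt
    + (sph lam (hyp t) * sphDecay lam s) * hws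

include hlam hlam₂ in
/-- **THE KERNEL RESOLVENT IDENTITY**: for all `t, s > 0`,
`(μ − μ₂) ∫_{(0,∞)} K_λ(t,r) K_{λ₂}(r,s) sinh 2r dr = K_λ(t,s) − K_{λ₂}(t,s)`. -/
theorem kernel_resolvent_identity {t s : ℝ} (ht : 0 < t) (hs : 0 < s) :
    (lam * (lam - 2) - lam₂ * (lam₂ - 2))
        * ∫ r in Ioi 0, sphGreenKernel lam t r * sphGreenKernel lam₂ r s * Real.sinh (2 * r)
      = sphGreenKernel lam t s - sphGreenKernel lam₂ t s := by
  rcases le_or_gt t s with hts | hst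
  · exact kernel_resolvent_identity_of_le hlam hlam₂ ht hts
  · -- symmetry: the integrand is that of `(λ₂, λ; s, t)`
    have h := kernel_resolvent_identity_of_le hlam₂ hlam hs hst.le
    have e : ∫ r in Ioi 0, sphGreenKernel lam t r * sphGreenKernel lam₂ r s * Real.sinh (2 * r)
        = ∫ r in Ioi 0, sphGreenKernel lam₂ s r * sphGreenKernel lam r t * Real.sinh (2 * r) := by
      apply MeasureTheory.integral_congr_ae
      refine Eventually.of_forall fun r => ?_
      simp only
      rw [sphGreenKernel_symm lam t r, sphGreenKernel_symm lam₂ r s]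
      ring
    rw [e, sphGreenKernel_symm lam t s, sphGreenKernel_symm lam₂ t s]
    linear_combination -h

include hlam hlam₂ in
/-- **The Fubini kernel of the composition is the difference quotient**: for `λ ≠ λ₂`,
`∫_{(0,∞)} K_λ(t,r) K_{λ₂}(r,s) sinh 2r dr = (K_λ(t,s) − K_{λ₂}(t,s))/(μ − μ₂)`. -/
theorem kernel_comp_eq (hne : lam ≠ lam₂) {t s : ℝ} (ht : 0 < t) (hs : 0 < s) :
    ∫ r in Ioi 0, sphGreenKernel lam t r * sphGreenKernel lam₂ r s * Real.sinh (2 * r)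
      = (sphGreenKernel lam t s - sphGreenKernel lam₂ t s) / (lam * (lam - 2) - lam₂ * (lam₂ - 2)) := by
  have hκ : lam * (lam - 2) - lam₂ * (lam₂ - 2) ≠ 0 := (mu_sub_ne_zero hlam hlam₂).mpr hne
  rw [eq_div_iff hκ, mul_comm]
  exact kernel_resolvent_identity hlam hlam₂ ht hs

include hlam hlam₂ in
/-- **THE COMPOSITION `G_λ G_{λ₂}` IS THE INTEGRAL OPERATOR WITH THE COMPOSED KERNEL** (Fubini form, without Fubini):
for `λ ≠ λ₂` and `f` supported in `[a, b]`,
`G^I_λ(G_{λ₂} f)(t) = ∫_a^b (∫_{(0,∞)} K_λ(t,r) K_{λ₂}(r,s) sinh 2r dr) f(s) sinh 2s ds`. -/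
theorem sphGreen_comp_eq_integral_kernel_comp (hne : lam ≠ lam₂) {a b : ℝ} {f : ℝ → ℝ}
    (hf : ContinuousOn f (Ioi 0)) (ha : 0 < a) (hab : a ≤ b) (hfa : ∀ s, s ≤ a → f s = 0)
    (hfb : ∀ s, b ≤ s → f s = 0) {t : ℝ} (ht : 0 < t) :
    greenSolI (fun t => sph lam (hyp t)) (sphDecay lam) (sphGreen lam₂ f a b) t
      = ∫ s in a..b, (∫ r in Ioi 0, sphGreenKernel lam t r * sphGreenKernel lam₂ r s * Real.sinh (2 * r))
          * f s * Real.sinh (2 * s) := by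
  rw [sphGreen_comp_eq_integral_kernel hlam hf ha hab hfa hfb hlam₂ hne ht]
  apply integral_congr
  intro s hs
  have hs0 : 0 < s := lt_of_lt_of_le ha (by rw [Set.uIcc_of_le hab] at hs; exact hs.1)
  simp only
  rw [kernel_comp_eq hlam hlam₂ hne ht hs0]

include hlam hlam₂ in
/-- The composed kernel is nonnegative: both kernels are negative. -/
theorem kernel_comp_nonneg {t s : ℝ} (ht : 0 < t) (hs : 0 < s) :
    0 ≤ ∫ r in Ioi 0, sphGreenKernel lam t r * sphGreenKernel lam₂ r s * Real.sinh (2 * r) := by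
  apply setIntegral_nonneg measurableSet_Ioi
  intro r hr
  have hr0 : 0 < r := hr
  have h1 : sphGreenKernel lam t r ≤ 0 := (sphGreenKernel_neg hlam ht).le
  have h2 : sphGreenKernel lam₂ r s ≤ 0 := by
    rw [sphGreenKernel_symm]
    exact (sphGreenKernel_neg hlam₂ hs).le
  exact mul_nonneg (mul_nonneg_of_nonpos_of_nonpos h1 h2) (Real.sinh_nonneg_iff.mpr (by linarith))

include hlam hlam₂ in
/-- **The Green's kernel is monotone in the spectral parameter**: `K_{λ₂}(t, s) ≤ K_λ(t, s) ≤ 0` for `1 < λ₂ ≤ λ`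
(the kernel resolvent identity with a nonnegative composed kernel and `μ − μ₂ = (λ − λ₂)(λ + λ₂ − 2) ≥ 0`). -/
theorem sphGreenKernel_mono (hle : lam₂ ≤ lam) {t s : ℝ} (ht : 0 < t) (hs : 0 < s) :
    sphGreenKernel lam₂ t s ≤ sphGreenKernel lam t s := by
  have h := kernel_resolvent_identity hlam hlam₂ ht hs
  have hκ : 0 ≤ lam * (lam - 2) - lam₂ * (lam₂ - 2) := by nlinarith
  have := mul_nonneg hκ (kernel_comp_nonneg hlam hlam₂ ht hs)
  linarith

end measure

end Summit.Ventures.HodgeRepro2.T5SU11KernelResolventIdentity
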